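import Mathlib
import HarnessLib
import Summits.HubbardSuperconductivity.HubbardSuperconductivity.Theorems.KLProgrammeKLRegimeEnginePairTransferDLineEdgeSplit3
import Summits.HubbardSuperconductivity.HubbardSuperconductivity.Theorems.KLProgrammeKLRegimeEnginePairTransferMemberPHSignedRowSharpTC

/-!
# Route `KLProgramme` — ENGINE item stmt-HubbardSuperconductivity-20437 `KLRegimeEngineV17F2`, class-#5 STEP (X).3 budget side, THE PINNED PAIR «88b»
# (`1 ≤ n`, `j′ = n+1`) / located-risk #14 «(X).3-PINNED-NUMERIC»: the signed `D`-rows under the kernel split `c + F₁ + F₂`, keyed on the SHARP row bound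
# `klmsRowBoundTC` (sharp zero-sound piece + path transfer constant + split Matsubara count) (cell gate-hubbard-kl, seat hubbard-kl-k3c2-p2 g22, technique «thermal-bar induction n ≤ nScales β + 1 with EngineBoundsAtV4S sums»)

Text-faithful twins (suffix `S`) of `klms_adjacent_direct_signed_le_gen` (…DLineEdgeSplit §1), `klms_adjacent_crossed_signed_le_gen` (…DLineEdgeSplitCrossed §1) and
`dLine_pinned_direct/crossed_signed_le_split3` (…DLineEdgeSplit3), with `klmsRowBound ↦ klmsRowBoundTC` and `klms_pinned_bubble_norm_le_gen ↦ …_genS`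
(…MemberPHSignedRowSharpZS: zero-sound piece `(64/π)·M_F·L_W·Λ` instead of `(524288/π)(ℓ+8M_F)·L_W·Λ`, 2^21.2 smaller); the window rows
(`klms_weighted_*_norm_le_of_support_soft`), the literal-sum algebra and every hypothesis are unchanged and imported.
Pure composition + algebra over landed rows; the split and its data are binders; nothing asserts (X).3, (c), K3 or superconductivity.
-/

noncomputable section

namespace Summit.HubbardSuperconductivity.HubbardSuperconductivity.Theorems.KLRegimeSplit

set_option linter.dupNamespace false -- summit = problem name (single-conjunct summit), D-0017

open Real Set Finset Complex Literature.MathematicalPhysics.QuantumLattice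
open Literature.Probability.LatticeModels hiding torusSupNorm
open Literature.MathematicalPhysics.QuantumLattice.BandSectorCounting
open Summit.HubbardSuperconductivity.HubbardSuperconductivity.Theorems.KLProgrammeLegKernels
open Summit.HubbardSuperconductivity.HubbardSuperconductivity.Theorems.KLRegimeWick
open Summit.HubbardSuperconductivity.HubbardSuperconductivity.Theorems.TwoPointAssembly
open Summit.HubbardSuperconductivity.HubbardSuperconductivity.Theorems.DispersionFlow
open Summit.HubbardSuperconductivity.HubbardSuperconductivity.Theorems.PerturbedFermiCurve

variable {L M : ℕ} [NeZero L] [NeZero M] (β μ : ℝ) (K : TrigPolyC4v)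

/-! ## §1 The adjacent-pair `D`-rows for a generic resolved kernel, sharp row bound (twins of …DLineEdgeSplit §1 / …DLineEdgeSplitCrossed §1) -/

section Gen

variable {a' b' : ℝ} (B : BandBounds a' b') {R : RenConsts} {U : ℝ} {N : ℕ} {A : ℝ}

/-- **ADJACENT-PAIR DIRECT `D`-ROW, GENERIC KERNEL**: pair `(j, n+1)`, `n+1 ≤ j`, `D = s_{n+1,j} − s_{n+1,n+1}` (profile `klPhiC Λ_j Λₙ₊₁`), window
`G|p_{x−y}|_𝕋 ≤ Λₙ₊₁/8`, resolved kernel `F` with momentum pin `F₀`: `A₀`/`L_A` bound the σ-summed pin along the lines `k ↦ (k, k + (x−y))` and `k ↦ (k − (x−y), k)`,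
`ε` the flatness of `F` against `F₀` on `ω² ≤ (4Λₙ₊₁)²` ⟹ `‖S_D[F]‖ ≤ (βL²)²(βL²·Row_j(G|p_{x−y}|) + βL²·Row_j(G|p_{x−y}|)) + ε·(512/3)(βL²)²/Λ(t)²·Σ|D|‖ĝ‖`. -/
theorem klms_adjacent_direct_signed_le_genTC (hR : ∀ j, 0 ≤ R.Gfr j) (hK : FrameOK R U N μ K)
    (hAb : ∀ p : Momentum, ∀ j ≤ 2, ‖iteratedFDeriv ℝ j (frameShift K) p‖ ≤ A) (hA : 4 * A < B.Dtmin) (hA20 : 4 * A ≤ 1 / 20) (hμ : μ ≤ -0.15)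
    (n : ℕ) {t : ℝ} (ht : t ∈ Icc (0 : ℝ) 1) (hβ : klBetaMin ≤ β) (hn : n + 1 ≤ nScales β + 1)
    (hM : β * (4 * klScale klE0 (n + 1)) / (2 * Real.pi) + 1 ≤ M)
    (Wd : ℝ → FreqMomentum L M → ℝ) (hWd : Wd = fun t k => deriv (fun Λ' : ℝ => hubbardCutoffWeightCT L M β μ K Λ' k) (klScale klE0 n + t * (klScale klE0 (n + 1) - klScale klE0 n)))
    {j : ℕ} (hj : n + 1 ≤ j) (x y : TorusSite 2 L)
    (hlo : a' < μ - 4 * klScale klE0 (n + 1) - 4 * A) (hhi : μ + 4 * klScale klE0 (n + 1) + 4 * A < b')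
    (hq : (4 + 8 / 3 * R.Gfr 1 * U ^ 2) * klTorusNorm L (x - y) ≤ klScale klE0 (n + 1) / 8)
    (F : FreqMomentum L M → Fin 2 → FreqMomentum L M → ℂ) (F₀ : TorusSite 2 L → Fin 2 → TorusSite 2 L → ℂ)
    {A₀ LA ε : ℝ} (hA0 : 0 ≤ A₀) (hLA : 0 ≤ LA) (hε : 0 ≤ ε)
    (hY0p : ∀ k : TorusSite 2 L, ‖∑ σ : Fin 2, F₀ k σ (k + (x - y))‖ ≤ A₀)
    (hY1p : ∀ k k' : TorusSite 2 L, ‖(∑ σ : Fin 2, F₀ k σ (k + (x - y))) - ∑ σ : Fin 2, F₀ k' σ (k' + (x - y))‖ ≤ LA * klTorusNorm L (k - k'))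
    (hY0m : ∀ k : TorusSite 2 L, ‖∑ σ : Fin 2, F₀ (k + -(x - y)) σ k‖ ≤ A₀)
    (hY1m : ∀ k k' : TorusSite 2 L, ‖(∑ σ : Fin 2, F₀ (k + -(x - y)) σ k) - ∑ σ : Fin 2, F₀ (k' + -(x - y)) σ k'‖ ≤ LA * klTorusNorm L (k - k'))
    (hflat : ∀ (i : MatsubaraIdx M) (σ : Fin 2) (k k' : TorusSite 2 L), matsubaraFreq β M i ^ 2 ≤ (4 * klScale klE0 (n + 1)) ^ 2 →
      ‖F (i, k) σ (i, k') - F₀ k σ k'‖ ≤ ε) :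
    ‖∑ p : FreqMomentum L M, ∑ σ : Fin 2, ∑ p' : FreqMomentum L M,
        if matsubaraInt M p'.1 + matsubaraInt M (omega0 M) = matsubaraInt M p.1 + matsubaraInt M (omega0 M) ∧ p'.2 = p.2 + x - y then
          ((((((softSymbolCompl L M β μ K (n + 1) j p - softSymbolCompl L M β μ K (n + 1) (n + 1) p) : ℝ) : ℂ) * (((β * (L : ℝ) ^ 2 : ℝ) : ℂ) * propCT L M β μ K p)) *
                ((((Wd t p') : ℝ) : ℂ) * (((β * (L : ℝ) ^ 2 : ℝ) : ℂ) * propCT L M β μ K p'))) +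
              (((((Wd t p) : ℝ) : ℂ) * (((β * (L : ℝ) ^ 2 : ℝ) : ℂ) * propCT L M β μ K p)) *
                ((((softSymbolCompl L M β μ K (n + 1) j p' - softSymbolCompl L M β μ K (n + 1) (n + 1) p') : ℝ) : ℂ) * (((β * (L : ℝ) ^ 2 : ℝ) : ℂ) * propCT L M β μ K p')))) *
            F p σ p'
        else 0‖ ≤
      (β * (L : ℝ) ^ 2) ^ 2 *
          (β * (L : ℝ) ^ 2 * klmsRowBoundTC B.Dtmin A (4 + 8 / 3 * R.Gfr 1 * U ^ 2) A₀ LA β n j ((4 + 8 / 3 * R.Gfr 1 * U ^ 2) * klTorusNorm L (x - y)) L +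
            β * (L : ℝ) ^ 2 * klmsRowBoundTC B.Dtmin A (4 + 8 / 3 * R.Gfr 1 * U ^ 2) A₀ LA β n j ((4 + 8 / 3 * R.Gfr 1 * U ^ 2) * klTorusNorm L (x - y)) L) +
        ε * (512 / 3 * (β * (L : ℝ) ^ 2) ^ 2 / (klScale klE0 n + t * (klScale klE0 (n + 1) - klScale klE0 n)) ^ 2 *
          ∑ p : FreqMomentum L M, |softSymbolCompl L M β μ K (n + 1) j p - softSymbolCompl L M β μ K (n + 1) (n + 1) p| * ‖propCT L M β μ K p‖) := by
  have hβ0 : 0 < β := lt_of_lt_of_le (by norm_num [klBetaMin]) hβ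
  have hΛ1 := klth_klScale_pos (n + 1)
  have hq0 : |(0 : ℝ)| ≤ klScale klE0 (n + 1) / 8 := by rw [abs_zero]; positivity
  have hhi1 : klScale klE0 (n + 1) ≤ klScale klE0 n := by rw [klth_klScale_succ]; linarith [klth_klScale_pos n]
  have h0 := klms_weighted_direct_norm_le β μ K hβ0 n ht (fun p => softSymbolCompl L M β μ K (n + 1) j p - softSymbolCompl L M β μ K (n + 1) (n + 1) p)
    (klPhiC (klScale klE0 j) (klScale klE0 (n + 1))) (fun p => klfw_dLine_line_eq μ K hβ0.ne' n j (n + 1) p) Wd hWd F F₀ x y hε hflat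
  have h1 := klms_pinned_bubble_norm_le_genTC β μ K B hR hK hAb hA hA20 hμ n ht hj le_rfl hhi1 hlo hhi hβ hn hM (x - y) hq hq0 hA0 hLA
    (Y := fun k : TorusSite 2 L => ∑ σ : Fin 2, F₀ k σ (k + (x - y))) hY0p hY1p
  have hq' : (4 + 8 / 3 * R.Gfr 1 * U ^ 2) * klTorusNorm L (-(x - y)) ≤ klScale klE0 (n + 1) / 8 := by rwa [klTorusNorm_neg]
  have h2 := klms_pinned_bubble_norm_le_genTC β μ K B hR hK hAb hA hA20 hμ n ht hj le_rfl hhi1 hlo hhi hβ hn hM (-(x - y)) hq' hq0 hA0 hLA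
    (Y := fun k : TorusSite 2 L => ∑ σ : Fin 2, F₀ (k + -(x - y)) σ k) hY0m hY1m
  simp only [add_zero, abs_zero, zero_add] at h1 h2
  rw [klTorusNorm_neg] at h2
  exact h0.trans (add_le_add (mul_le_mul_of_nonneg_left (add_le_add h1 h2) (by positivity)) le_rfl)

/-- **ADJACENT-PAIR CROSSED `D`-ROW, GENERIC KERNEL**: pair `(j, n+1)`, `n+1 ≤ j`, `D = s_{n+1,j} − s_{n+1,n+1}`, `q̃ = Q_m − x − y` with `G|p_q̃|_𝕋 ≤ Λₙ₊₁/8`, `16π/β ≤ Λₙ₊₁`,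
kernel `F` with momentum pin `F₀` (`A₀`/`L_A` on `k ↦ F₀ k (k + q̃)` and `k ↦ F₀ (k − q̃) k`; `ε` the crossed flatness) ⟹
`‖S_{D,x}[F]‖ ≤ (βL²)²(βL²·Row_j(|−2π/β| + G|p_q̃|) + βL²·Row_j(|2π/β| + G|p_q̃|)) + ε·(256/3)(βL²)²/Λ(t)²·Σ|D|‖ĝ‖`. -/
theorem klms_adjacent_crossed_signed_le_genTC (hR : ∀ j, 0 ≤ R.Gfr j) (hK : FrameOK R U N μ K)
    (hAb : ∀ p : Momentum, ∀ j ≤ 2, ‖iteratedFDeriv ℝ j (frameShift K) p‖ ≤ A) (hA : 4 * A < B.Dtmin) (hA20 : 4 * A ≤ 1 / 20) (hμ : μ ≤ -0.15)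
    (n : ℕ) {t : ℝ} (ht : t ∈ Icc (0 : ℝ) 1) (hβ : klBetaMin ≤ β) (hn : n + 1 ≤ nScales β + 1) (hβn : 16 * π / β ≤ klScale klE0 (n + 1))
    (hM : β * (4 * klScale klE0 (n + 1)) / (2 * Real.pi) + 1 ≤ M)
    (Wd : ℝ → FreqMomentum L M → ℝ) (hWd : Wd = fun t k => deriv (fun Λ' : ℝ => hubbardCutoffWeightCT L M β μ K Λ' k) (klScale klE0 n + t * (klScale klE0 (n + 1) - klScale klE0 n)))
    {j : ℕ} (hj : n + 1 ≤ j) (Qm x y : TorusSite 2 L)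
    (hlo : a' < μ - 4 * klScale klE0 (n + 1) - 4 * A) (hhi : μ + 4 * klScale klE0 (n + 1) + 4 * A < b')
    (hq : (4 + 8 / 3 * R.Gfr 1 * U ^ 2) * klTorusNorm L (Qm - x - y) ≤ klScale klE0 (n + 1) / 8)
    (F : FreqMomentum L M → FreqMomentum L M → ℂ) (F₀ : TorusSite 2 L → TorusSite 2 L → ℂ)
    {A₀ LA ε : ℝ} (hA0 : 0 ≤ A₀) (hLA : 0 ≤ LA) (hε : 0 ≤ ε)
    (hY0B : ∀ k : TorusSite 2 L, ‖F₀ k (k + (Qm - x - y))‖ ≤ A₀)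
    (hY1B : ∀ k k' : TorusSite 2 L, ‖F₀ k (k + (Qm - x - y)) - F₀ k' (k' + (Qm - x - y))‖ ≤ LA * klTorusNorm L (k - k'))
    (hY0A : ∀ k : TorusSite 2 L, ‖F₀ (k + -(Qm - x - y)) k‖ ≤ A₀)
    (hY1A : ∀ k k' : TorusSite 2 L, ‖F₀ (k + -(Qm - x - y)) k - F₀ (k' + -(Qm - x - y)) k'‖ ≤ LA * klTorusNorm L (k - k'))
    (hflat : ∀ (i i' : MatsubaraIdx M) (k k' : TorusSite 2 L), matsubaraInt M i' + 1 = matsubaraInt M i →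
      matsubaraFreq β M i ^ 2 ≤ (5 * klScale klE0 (n + 1)) ^ 2 → ‖F (i, k) (i', k') - F₀ k k'‖ ≤ ε) :
    ‖∑ p : FreqMomentum L M, ∑ p' : FreqMomentum L M,
        if matsubaraInt M p'.1 + matsubaraInt M (omega0 M) + matsubaraInt M (omega0 M) + 1 = matsubaraInt M p.1 ∧ p'.2 = p.2 + Qm - x - y then
          ((((((softSymbolCompl L M β μ K (n + 1) j p - softSymbolCompl L M β μ K (n + 1) (n + 1) p) : ℝ) : ℂ) * (((β * (L : ℝ) ^ 2 : ℝ) : ℂ) * propCT L M β μ K p)) *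
                ((((Wd t p') : ℝ) : ℂ) * (((β * (L : ℝ) ^ 2 : ℝ) : ℂ) * propCT L M β μ K p'))) +
              (((((Wd t p) : ℝ) : ℂ) * (((β * (L : ℝ) ^ 2 : ℝ) : ℂ) * propCT L M β μ K p)) *
                ((((softSymbolCompl L M β μ K (n + 1) j p' - softSymbolCompl L M β μ K (n + 1) (n + 1) p') : ℝ) : ℂ) * (((β * (L : ℝ) ^ 2 : ℝ) : ℂ) * propCT L M β μ K p')))) *
            F p p'
        else 0‖ ≤
      (β * (L : ℝ) ^ 2) ^ 2 *
          (β * (L : ℝ) ^ 2 * klmsRowBoundTC B.Dtmin A (4 + 8 / 3 * R.Gfr 1 * U ^ 2) A₀ LA β n j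
              (|-(2 * π / β)| + (4 + 8 / 3 * R.Gfr 1 * U ^ 2) * klTorusNorm L (Qm - x - y)) L +
            β * (L : ℝ) ^ 2 * klmsRowBoundTC B.Dtmin A (4 + 8 / 3 * R.Gfr 1 * U ^ 2) A₀ LA β n j
              (|2 * π / β| + (4 + 8 / 3 * R.Gfr 1 * U ^ 2) * klTorusNorm L (Qm - x - y)) L) +
        ε * (256 / 3 * (β * (L : ℝ) ^ 2) ^ 2 / (klScale klE0 n + t * (klScale klE0 (n + 1) - klScale klE0 n)) ^ 2 *
          ∑ p : FreqMomentum L M, |softSymbolCompl L M β μ K (n + 1) j p - softSymbolCompl L M β μ K (n + 1) (n + 1) p| * ‖propCT L M β μ K p‖) := by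
  have hβ0 : 0 < β := lt_of_lt_of_le (by norm_num [klBetaMin]) hβ
  have hhi1 : klScale klE0 (n + 1) ≤ klScale klE0 n := by rw [klth_klScale_succ]; linarith [klth_klScale_pos n]
  have h0 := klms_weighted_crossed_norm_le β μ K hβ0 n ht hβn hM
    (fun p => softSymbolCompl L M β μ K (n + 1) j p - softSymbolCompl L M β μ K (n + 1) (n + 1) p)
    (klPhiC (klScale klE0 j) (klScale klE0 (n + 1))) (fun p => klfw_dLine_line_eq μ K hβ0.ne' n j (n + 1) p) Wd hWd F F₀ Qm x y hε hflat
  have h2π : |2 * π / β| ≤ klScale klE0 (n + 1) / 8 := by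
    rw [abs_of_pos (by positivity)]
    have : 2 * π / β = (16 * π / β) / 8 := by ring
    rw [this]; exact div_le_div_of_nonneg_right hβn (by norm_num)
  have h2π' : |-(2 * π / β)| ≤ klScale klE0 (n + 1) / 8 := by rw [abs_neg]; exact h2π
  have h1 := klms_pinned_bubble_norm_le_genTC β μ K B hR hK hAb hA hA20 hμ n ht hj le_rfl hhi1 hlo hhi hβ hn hM (Qm - x - y) hq h2π' hA0 hLA
    (Y := fun k : TorusSite 2 L => F₀ k (k + (Qm - x - y))) hY0B hY1B
  have hq' : (4 + 8 / 3 * R.Gfr 1 * U ^ 2) * klTorusNorm L (-(Qm - x - y)) ≤ klScale klE0 (n + 1) / 8 := by rwa [klTorusNorm_neg]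
  have h2 := klms_pinned_bubble_norm_le_genTC β μ K B hR hK hAb hA hA20 hμ n ht hj le_rfl hhi1 hlo hhi hβ hn hM (-(Qm - x - y)) hq' h2π hA0 hLA
    (Y := fun k : TorusSite 2 L => F₀ (k + -(Qm - x - y)) k) hY0A hY1A
  rw [klTorusNorm_neg] at h2
  exact h0.trans (add_le_add (mul_le_mul_of_nonneg_left (add_le_add h1 h2) (by positivity)) le_rfl)

end Gen

/-! ## §2 The pinned-pair `D`-rows under the three-way kernel split, sharp row bound (twins of …DLineEdgeSplit3) -/

section Split3

variable {a' b' : ℝ} (B : BandBounds a' b') {R : RenConsts} {U : ℝ} {N : ℕ} {A : ℝ}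

/-- **THE PINNED PAIR's DIRECT `D`-ROW, THREE-WAY SPLIT `V_j⊗V_j = c + F₁ + F₂`** (`n+2 ≤ j`, window `G|p_{x−y}| ≤ Λₙ₊₁/8`, read at `n+2`): `c` constant (data
`(2‖c‖, 0, 0)`, proved), `F₁` with generic-row data `(A₁, L₁, ε₁)` against its pin `F₁₀`, `F₂` of sup `A₂` supported in `|k − cen|_𝕋 ≤ ρ` (loop momentum) ⟹
`‖S_D‖ ≤ c-row + (F₁-row + ε₁·flat) + A₂·(512/3)(βL²)²/Λ(t)²·(2·(15381(ρ/π + 1/L)·Λₙ₊₁·βL²))`. -/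
theorem dLine_pinned_direct_signed_le_split3TC (hR : ∀ j, 0 ≤ R.Gfr j) (hK : FrameOK R U N μ K)
    (hAb : ∀ p : Momentum, ∀ j ≤ 2, ‖iteratedFDeriv ℝ j (frameShift K) p‖ ≤ A) (hA : 4 * A < B.Dtmin) (hA20 : 4 * A ≤ 1 / 20) (hμ : μ ≤ -0.15)
    (n : ℕ) {t : ℝ} (ht : t ∈ Icc (0 : ℝ) 1) (hβ : klBetaMin ≤ β) (hβL : β ≤ L) (hn : n + 1 ≤ nScales β + 1)
    (hM : β * (4 * klScale klE0 (n + 1)) / (2 * Real.pi) + 1 ≤ M)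
    (Wd : ℝ → FreqMomentum L M → ℝ) (hWd : Wd = fun t k => deriv (fun Λ' : ℝ => hubbardCutoffWeightCT L M β μ K Λ' k) (klScale klE0 n + t * (klScale klE0 (n + 1) - klScale klE0 n)))
    (V : ℕ → ℝ → (Fin 4 → HubbardFieldIdx L M) → ℂ) {j : ℕ} (hj : n + 2 ≤ j) (Qm x y : TorusSite 2 L)
    (hlo : a' < μ - 4 * klScale klE0 (n + 1) - 4 * A) (hhi : μ + 4 * klScale klE0 (n + 1) + 4 * A < b')
    (hq : (4 + 8 / 3 * R.Gfr 1 * U ^ 2) * klTorusNorm L (x - y) ≤ klScale klE0 (n + 1) / 8)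
    (c : ℂ) (F₁ F₂ : FreqMomentum L M → Fin 2 → FreqMomentum L M → ℂ) (F₁₀ : TorusSite 2 L → Fin 2 → TorusSite 2 L → ℂ)
    (hsplit : ∀ (p : FreqMomentum L M) (σ : Fin 2) (p' : FreqMomentum L M),
      V j t ![((p, σ), 1), ((p', σ), 0), (((omega0 M, y), 0), 0), (((omega0 M, x), 0), 1)] *
          V j t ![((p, σ), 0), ((p', σ), 1), ((((omega0 M).rev, Qm - y), 1), 0), ((((omega0 M).rev, Qm - x), 1), 1)] = c + F₁ p σ p' + F₂ p σ p')
    {A₁ L₁ ε₁ : ℝ} (hA1 : 0 ≤ A₁) (hL1 : 0 ≤ L₁) (hε1 : 0 ≤ ε₁)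
    (hY0p₁ : ∀ k : TorusSite 2 L, ‖∑ σ : Fin 2, F₁₀ k σ (k + (x - y))‖ ≤ A₁)
    (hY1p₁ : ∀ k k' : TorusSite 2 L, ‖(∑ σ : Fin 2, F₁₀ k σ (k + (x - y))) - ∑ σ : Fin 2, F₁₀ k' σ (k' + (x - y))‖ ≤ L₁ * klTorusNorm L (k - k'))
    (hY0m₁ : ∀ k : TorusSite 2 L, ‖∑ σ : Fin 2, F₁₀ (k + -(x - y)) σ k‖ ≤ A₁)
    (hY1m₁ : ∀ k k' : TorusSite 2 L, ‖(∑ σ : Fin 2, F₁₀ (k + -(x - y)) σ k) - ∑ σ : Fin 2, F₁₀ (k' + -(x - y)) σ k'‖ ≤ L₁ * klTorusNorm L (k - k'))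
    (hflat₁ : ∀ (i : MatsubaraIdx M) (σ : Fin 2) (k k' : TorusSite 2 L), matsubaraFreq β M i ^ 2 ≤ (4 * klScale klE0 (n + 1)) ^ 2 →
      ‖F₁ (i, k) σ (i, k') - F₁₀ k σ k'‖ ≤ ε₁)
    (cen : TorusSite 2 L) {ρ A₂ : ℝ} (hρ : 0 ≤ ρ) (hA2 : 0 ≤ A₂)
    (hF₂ : ∀ (p : FreqMomentum L M) (σ : Fin 2) (p' : FreqMomentum L M), ‖F₂ p σ p'‖ ≤ A₂)
    (hsupp₂ : ∀ (p : FreqMomentum L M) (σ : Fin 2) (p' : FreqMomentum L M), ρ < klTorusNorm L (p.2 - cen) → F₂ p σ p' = 0) :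
    ‖∑ p : FreqMomentum L M, ∑ σ : Fin 2, ∑ p' : FreqMomentum L M,
        if matsubaraInt M p'.1 + matsubaraInt M (omega0 M) = matsubaraInt M p.1 + matsubaraInt M (omega0 M) ∧ p'.2 = p.2 + x - y then
          ((((((softSymbolCompl L M β μ K (n + 1) j p - softSymbolCompl L M β μ K (n + 1) (n + 1) p) : ℝ) : ℂ) * (((β * (L : ℝ) ^ 2 : ℝ) : ℂ) * propCT L M β μ K p)) *
                ((((Wd t p') : ℝ) : ℂ) * (((β * (L : ℝ) ^ 2 : ℝ) : ℂ) * propCT L M β μ K p'))) +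
              (((((Wd t p) : ℝ) : ℂ) * (((β * (L : ℝ) ^ 2 : ℝ) : ℂ) * propCT L M β μ K p)) *
                ((((softSymbolCompl L M β μ K (n + 1) j p' - softSymbolCompl L M β μ K (n + 1) (n + 1) p') : ℝ) : ℂ) * (((β * (L : ℝ) ^ 2 : ℝ) : ℂ) * propCT L M β μ K p')))) *
            (V j t ![((p, σ), 1), ((p', σ), 0), (((omega0 M, y), 0), 0), (((omega0 M, x), 0), 1)] *
              V j t ![((p, σ), 0), ((p', σ), 1), ((((omega0 M).rev, Qm - y), 1), 0), ((((omega0 M).rev, Qm - x), 1), 1)])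
        else 0‖ ≤
      (β * (L : ℝ) ^ 2) ^ 2 *
          (β * (L : ℝ) ^ 2 * klmsRowBoundTC B.Dtmin A (4 + 8 / 3 * R.Gfr 1 * U ^ 2) (2 * ‖c‖) 0 β n (n + 2) ((4 + 8 / 3 * R.Gfr 1 * U ^ 2) * klTorusNorm L (x - y)) L +
            β * (L : ℝ) ^ 2 * klmsRowBoundTC B.Dtmin A (4 + 8 / 3 * R.Gfr 1 * U ^ 2) (2 * ‖c‖) 0 β n (n + 2) ((4 + 8 / 3 * R.Gfr 1 * U ^ 2) * klTorusNorm L (x - y)) L) +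
      ((β * (L : ℝ) ^ 2) ^ 2 *
          (β * (L : ℝ) ^ 2 * klmsRowBoundTC B.Dtmin A (4 + 8 / 3 * R.Gfr 1 * U ^ 2) A₁ L₁ β n (n + 2) ((4 + 8 / 3 * R.Gfr 1 * U ^ 2) * klTorusNorm L (x - y)) L +
            β * (L : ℝ) ^ 2 * klmsRowBoundTC B.Dtmin A (4 + 8 / 3 * R.Gfr 1 * U ^ 2) A₁ L₁ β n (n + 2) ((4 + 8 / 3 * R.Gfr 1 * U ^ 2) * klTorusNorm L (x - y)) L) +
        ε₁ * (512 / 3 * (β * (L : ℝ) ^ 2) ^ 2 / (klScale klE0 n + t * (klScale klE0 (n + 1) - klScale klE0 n)) ^ 2 *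
          ∑ p : FreqMomentum L M, |softSymbolCompl L M β μ K (n + 1) (n + 2) p - softSymbolCompl L M β μ K (n + 1) (n + 1) p| * ‖propCT L M β μ K p‖)) +
      A₂ * (512 / 3 * (β * (L : ℝ) ^ 2) ^ 2 / (klScale klE0 n + t * (klScale klE0 (n + 1) - klScale klE0 n)) ^ 2 *
        (2 * (15381 * (ρ / π + ((L : ℝ))⁻¹) * klScale klE0 (n + 1) * β * (L : ℝ) ^ 2))) := by
  have hβ0 : 0 < β := lt_of_lt_of_le (by norm_num [klBetaMin]) hβ
  have hΛ1 := klth_klScale_pos (n + 1)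
  have hq' : (4 + 8 / 3 * R.Gfr 1 * U ^ 2) * klTorusNorm L (x - y) ≤ (klScale klE0 n + t * (klScale klE0 (n + 1) - klScale klE0 n)) / 6 := by
    have := (scaleAt_mem n ht).1; linarith
  -- (1) reduce the weight to `s_{n+1,n+2} − s_{n+1,n+1}`
  rw [klms_weighted_direct_eq_near β μ K hR hK n hj ht hq'
    (fun p => softSymbolCompl L M β μ K (n + 1) j p - softSymbolCompl L M β μ K (n + 1) (n + 1) p)
    (fun p => softSymbolCompl L M β μ K (n + 1) (n + 2) p - softSymbolCompl L M β μ K (n + 1) (n + 1) p) (fun k => by ring) Wd hWd]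
  -- (2) split the kernel twice
  set P : FreqMomentum L M → FreqMomentum L M → Prop := fun p p' =>
    matsubaraInt M p'.1 + matsubaraInt M (omega0 M) = matsubaraInt M p.1 + matsubaraInt M (omega0 M) ∧ p'.2 = p.2 + x - y with hP
  set ln : FreqMomentum L M → FreqMomentum L M → ℂ := fun p p' =>
    (((((softSymbolCompl L M β μ K (n + 1) (n + 2) p - softSymbolCompl L M β μ K (n + 1) (n + 1) p) : ℝ) : ℂ) * (((β * (L : ℝ) ^ 2 : ℝ) : ℂ) * propCT L M β μ K p)) *
        ((((Wd t p') : ℝ) : ℂ) * (((β * (L : ℝ) ^ 2 : ℝ) : ℂ) * propCT L M β μ K p'))) +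
      (((((Wd t p) : ℝ) : ℂ) * (((β * (L : ℝ) ^ 2 : ℝ) : ℂ) * propCT L M β μ K p)) *
        ((((softSymbolCompl L M β μ K (n + 1) (n + 2) p' - softSymbolCompl L M β μ K (n + 1) (n + 1) p') : ℝ) : ℂ) * (((β * (L : ℝ) ^ 2 : ℝ) : ℂ) * propCT L M β μ K p'))) with hln
  have e := ((pinned_direct_sum_kernel_congr P ln hsplit).trans (pinned_direct_sum_kernel_add P ln (fun p σ p' => c + F₁ p σ p') F₂)).trans
    (congrArg (· + _) (pinned_direct_sum_kernel_add P ln (fun _ _ _ => c) F₁))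
  simp only [hP, hln] at e
  rw [e]
  -- (3) the three rows at index `n+2`
  have h2c : ∀ k : TorusSite 2 L, ‖∑ _σ : Fin 2, (fun (_ : TorusSite 2 L) (_ : Fin 2) (_ : TorusSite 2 L) => c) k 0 k‖ ≤ 2 * ‖c‖ := fun k => by
    simp only [Finset.sum_const, Finset.card_univ, Fintype.card_fin, nsmul_eq_mul, Nat.cast_ofNat, norm_mul, Complex.norm_ofNat, le_refl]
  have hc := klms_adjacent_direct_signed_le_genTC β μ K B hR hK hAb hA hA20 hμ n ht hβ hn hM Wd hWd (j := n + 2) (by omega) x y hlo hhi hq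
    (fun _ _ _ => c) (fun _ _ _ => c) (A₀ := 2 * ‖c‖) (LA := 0) (ε := 0) (by positivity) le_rfl le_rfl
    (fun k => h2c k) (fun k k' => by simp) (fun k => h2c k) (fun k k' => by simp) (fun i σ k k' _ => by simp)
  rw [zero_mul, add_zero] at hc
  have h1 := klms_adjacent_direct_signed_le_genTC β μ K B hR hK hAb hA hA20 hμ n ht hβ hn hM Wd hWd (j := n + 2) (by omega) x y hlo hhi hq F₁ F₁₀
    hA1 hL1 hε1 hY0p₁ hY1p₁ hY0m₁ hY1m₁ hflat₁
  have hw : ∀ k : FreqMomentum L M, 0 ≤ (fun p : FreqMomentum L M => softSymbolCompl L M β μ K (n + 1) (n + 2) p - softSymbolCompl L M β μ K (n + 1) (n + 1) p) k ∧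
      (fun p : FreqMomentum L M => softSymbolCompl L M β μ K (n + 1) (n + 2) p - softSymbolCompl L M β μ K (n + 1) (n + 1) p) k ≤
        1 - hubbardCutoffWeightCT L M β μ K (klScale klE0 (n + 1)) k :=
    fun k => softSymbolCompl_sub_compl_mem β μ K (n + 1) (show n + 1 ≤ n + 2 by omega) k
  have h2 := klms_weighted_direct_norm_le_of_support_soft β μ K hK hβ hβL n (n + 1) ht hw Wd hWd F₂ x y cen hρ hA2 hF₂ hsupp₂
  exact (norm_add_le _ _).trans (add_le_add ((norm_add_le _ _).trans (add_le_add hc h1)) h2)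

/-- **THE PINNED PAIR's CROSSED `D`-ROW, THREE-WAY SPLIT `V_j⊗V_j = c + F₁ + F₂`** (`n+2 ≤ j`, window `G|p_{Q_m−x−y}| ≤ Λₙ₊₁/16`, `16π/β ≤ Λₙ₊₁`, read at
`n+2`): `c` constant (data `(‖c‖, 0, 0)`), `F₁` with data `(A₁, L₁, ε₁)`, `F₂` of sup `A₂` supported in `|k − cen|_𝕋 ≤ ρ` ⟹
`‖S_{D,x}‖ ≤ c-row + (F₁-row + ε₁·flat) + A₂·(256/3)(βL²)²/Λ(t)²·(2·(15381(ρ/π + 1/L)·Λₙ₊₁·βL²))`. -/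
theorem dLine_pinned_crossed_signed_le_split3TC (hR : ∀ j, 0 ≤ R.Gfr j) (hK : FrameOK R U N μ K)
    (hAb : ∀ p : Momentum, ∀ j ≤ 2, ‖iteratedFDeriv ℝ j (frameShift K) p‖ ≤ A) (hA : 4 * A < B.Dtmin) (hA20 : 4 * A ≤ 1 / 20) (hμ : μ ≤ -0.15)
    (n : ℕ) {t : ℝ} (ht : t ∈ Icc (0 : ℝ) 1) (hβ : klBetaMin ≤ β) (hβL : β ≤ L) (hn : n + 1 ≤ nScales β + 1) (hβn : 16 * π / β ≤ klScale klE0 (n + 1))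
    (hM : β * (4 * klScale klE0 (n + 1)) / (2 * Real.pi) + 1 ≤ M)
    (Wd : ℝ → FreqMomentum L M → ℝ) (hWd : Wd = fun t k => deriv (fun Λ' : ℝ => hubbardCutoffWeightCT L M β μ K Λ' k) (klScale klE0 n + t * (klScale klE0 (n + 1) - klScale klE0 n)))
    (V : ℕ → ℝ → (Fin 4 → HubbardFieldIdx L M) → ℂ) {j : ℕ} (hj : n + 2 ≤ j) (Qm x y : TorusSite 2 L)
    (hlo : a' < μ - 4 * klScale klE0 (n + 1) - 4 * A) (hhi : μ + 4 * klScale klE0 (n + 1) + 4 * A < b')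
    (hq : (4 + 8 / 3 * R.Gfr 1 * U ^ 2) * klTorusNorm L (Qm - x - y) ≤ klScale klE0 (n + 1) / 16)
    (c : ℂ) (F₁ F₂ : FreqMomentum L M → FreqMomentum L M → ℂ) (F₁₀ : TorusSite 2 L → TorusSite 2 L → ℂ)
    (hsplit : ∀ (p p' : FreqMomentum L M),
      V j t ![((p, 0), 1), ((p', 1), 0), (((omega0 M, y), 0), 0), ((((omega0 M).rev, Qm - x), 1), 1)] *
          V j t ![((p, 0), 0), ((p', 1), 1), ((((omega0 M).rev, Qm - y), 1), 0), (((omega0 M, x), 0), 1)] = c + F₁ p p' + F₂ p p')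
    {A₁ L₁ ε₁ : ℝ} (hA1 : 0 ≤ A₁) (hL1 : 0 ≤ L₁) (hε1 : 0 ≤ ε₁)
    (hY0B₁ : ∀ k : TorusSite 2 L, ‖F₁₀ k (k + (Qm - x - y))‖ ≤ A₁)
    (hY1B₁ : ∀ k k' : TorusSite 2 L, ‖F₁₀ k (k + (Qm - x - y)) - F₁₀ k' (k' + (Qm - x - y))‖ ≤ L₁ * klTorusNorm L (k - k'))
    (hY0A₁ : ∀ k : TorusSite 2 L, ‖F₁₀ (k + -(Qm - x - y)) k‖ ≤ A₁)
    (hY1A₁ : ∀ k k' : TorusSite 2 L, ‖F₁₀ (k + -(Qm - x - y)) k - F₁₀ (k' + -(Qm - x - y)) k'‖ ≤ L₁ * klTorusNorm L (k - k'))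
    (hflat₁ : ∀ (i i' : MatsubaraIdx M) (k k' : TorusSite 2 L), matsubaraInt M i' + 1 = matsubaraInt M i →
      matsubaraFreq β M i ^ 2 ≤ (5 * klScale klE0 (n + 1)) ^ 2 → ‖F₁ (i, k) (i', k') - F₁₀ k k'‖ ≤ ε₁)
    (cen : TorusSite 2 L) {ρ A₂ : ℝ} (hρ : 0 ≤ ρ) (hA2 : 0 ≤ A₂)
    (hF₂ : ∀ (p p' : FreqMomentum L M), ‖F₂ p p'‖ ≤ A₂)
    (hsupp₂ : ∀ (p p' : FreqMomentum L M), ρ < klTorusNorm L (p.2 - cen) → F₂ p p' = 0) :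
    ‖∑ p : FreqMomentum L M, ∑ p' : FreqMomentum L M,
        if matsubaraInt M p'.1 + matsubaraInt M (omega0 M) + matsubaraInt M (omega0 M) + 1 = matsubaraInt M p.1 ∧ p'.2 = p.2 + Qm - x - y then
          ((((((softSymbolCompl L M β μ K (n + 1) j p - softSymbolCompl L M β μ K (n + 1) (n + 1) p) : ℝ) : ℂ) * (((β * (L : ℝ) ^ 2 : ℝ) : ℂ) * propCT L M β μ K p)) *
                ((((Wd t p') : ℝ) : ℂ) * (((β * (L : ℝ) ^ 2 : ℝ) : ℂ) * propCT L M β μ K p'))) +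
              (((((Wd t p) : ℝ) : ℂ) * (((β * (L : ℝ) ^ 2 : ℝ) : ℂ) * propCT L M β μ K p)) *
                ((((softSymbolCompl L M β μ K (n + 1) j p' - softSymbolCompl L M β μ K (n + 1) (n + 1) p') : ℝ) : ℂ) * (((β * (L : ℝ) ^ 2 : ℝ) : ℂ) * propCT L M β μ K p')))) *
            (V j t ![((p, 0), 1), ((p', 1), 0), (((omega0 M, y), 0), 0), ((((omega0 M).rev, Qm - x), 1), 1)] *
              V j t ![((p, 0), 0), ((p', 1), 1), ((((omega0 M).rev, Qm - y), 1), 0), (((omega0 M, x), 0), 1)])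
        else 0‖ ≤
      (β * (L : ℝ) ^ 2) ^ 2 *
          (β * (L : ℝ) ^ 2 * klmsRowBoundTC B.Dtmin A (4 + 8 / 3 * R.Gfr 1 * U ^ 2) ‖c‖ 0 β n (n + 2)
              (|-(2 * π / β)| + (4 + 8 / 3 * R.Gfr 1 * U ^ 2) * klTorusNorm L (Qm - x - y)) L +
            β * (L : ℝ) ^ 2 * klmsRowBoundTC B.Dtmin A (4 + 8 / 3 * R.Gfr 1 * U ^ 2) ‖c‖ 0 β n (n + 2)
              (|2 * π / β| + (4 + 8 / 3 * R.Gfr 1 * U ^ 2) * klTorusNorm L (Qm - x - y)) L) +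
      ((β * (L : ℝ) ^ 2) ^ 2 *
          (β * (L : ℝ) ^ 2 * klmsRowBoundTC B.Dtmin A (4 + 8 / 3 * R.Gfr 1 * U ^ 2) A₁ L₁ β n (n + 2)
              (|-(2 * π / β)| + (4 + 8 / 3 * R.Gfr 1 * U ^ 2) * klTorusNorm L (Qm - x - y)) L +
            β * (L : ℝ) ^ 2 * klmsRowBoundTC B.Dtmin A (4 + 8 / 3 * R.Gfr 1 * U ^ 2) A₁ L₁ β n (n + 2)
              (|2 * π / β| + (4 + 8 / 3 * R.Gfr 1 * U ^ 2) * klTorusNorm L (Qm - x - y)) L) +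
        ε₁ * (256 / 3 * (β * (L : ℝ) ^ 2) ^ 2 / (klScale klE0 n + t * (klScale klE0 (n + 1) - klScale klE0 n)) ^ 2 *
          ∑ p : FreqMomentum L M, |softSymbolCompl L M β μ K (n + 1) (n + 2) p - softSymbolCompl L M β μ K (n + 1) (n + 1) p| * ‖propCT L M β μ K p‖)) +
      A₂ * (256 / 3 * (β * (L : ℝ) ^ 2) ^ 2 / (klScale klE0 n + t * (klScale klE0 (n + 1) - klScale klE0 n)) ^ 2 *
        (2 * (15381 * (ρ / π + ((L : ℝ))⁻¹) * klScale klE0 (n + 1) * β * (L : ℝ) ^ 2))) := by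
  have hβ0 : 0 < β := lt_of_lt_of_le (by norm_num [klBetaMin]) hβ
  have hΛ1 := klth_klScale_pos (n + 1)
  have hq' : (4 + 8 / 3 * R.Gfr 1 * U ^ 2) * klTorusNorm L (Qm - x - y) ≤ (klScale klE0 n + t * (klScale klE0 (n + 1) - klScale klE0 n)) / 13 := by
    have := (scaleAt_mem n ht).1; linarith
  have hq8 : (4 + 8 / 3 * R.Gfr 1 * U ^ 2) * klTorusNorm L (Qm - x - y) ≤ klScale klE0 (n + 1) / 8 := by linarith
  -- (1) reduce the weight to `s_{n+1,n+2} − s_{n+1,n+1}`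
  rw [klms_weighted_crossed_eq_near β μ K hR hK hβ0 n hβn hj ht hq'
    (fun p => softSymbolCompl L M β μ K (n + 1) j p - softSymbolCompl L M β μ K (n + 1) (n + 1) p)
    (fun p => softSymbolCompl L M β μ K (n + 1) (n + 2) p - softSymbolCompl L M β μ K (n + 1) (n + 1) p) (fun k => by ring) Wd hWd]
  -- (2) split the kernel twice
  set P : FreqMomentum L M → FreqMomentum L M → Prop := fun p p' =>
    matsubaraInt M p'.1 + matsubaraInt M (omega0 M) + matsubaraInt M (omega0 M) + 1 = matsubaraInt M p.1 ∧ p'.2 = p.2 + Qm - x - y with hP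
  set ln : FreqMomentum L M → FreqMomentum L M → ℂ := fun p p' =>
    (((((softSymbolCompl L M β μ K (n + 1) (n + 2) p - softSymbolCompl L M β μ K (n + 1) (n + 1) p) : ℝ) : ℂ) * (((β * (L : ℝ) ^ 2 : ℝ) : ℂ) * propCT L M β μ K p)) *
        ((((Wd t p') : ℝ) : ℂ) * (((β * (L : ℝ) ^ 2 : ℝ) : ℂ) * propCT L M β μ K p'))) +
      (((((Wd t p) : ℝ) : ℂ) * (((β * (L : ℝ) ^ 2 : ℝ) : ℂ) * propCT L M β μ K p)) *
        ((((softSymbolCompl L M β μ K (n + 1) (n + 2) p' - softSymbolCompl L M β μ K (n + 1) (n + 1) p') : ℝ) : ℂ) * (((β * (L : ℝ) ^ 2 : ℝ) : ℂ) * propCT L M β μ K p'))) with hln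
  have e := ((pinned_crossed_sum_kernel_congr P ln hsplit).trans (pinned_crossed_sum_kernel_add P ln (fun p p' => c + F₁ p p') F₂)).trans
    (congrArg (· + _) (pinned_crossed_sum_kernel_add P ln (fun _ _ => c) F₁))
  simp only [hP, hln] at e
  rw [e]
  -- (3) the three rows at index `n+2`
  have hc := klms_adjacent_crossed_signed_le_genTC β μ K B hR hK hAb hA hA20 hμ n ht hβ hn hβn hM Wd hWd (j := n + 2) (by omega) Qm x y hlo hhi hq8
    (fun _ _ => c) (fun _ _ => c) (A₀ := ‖c‖) (LA := 0) (ε := 0) (norm_nonneg c) le_rfl le_rfl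
    (fun k => le_rfl) (fun k k' => by simp) (fun k => le_rfl) (fun k k' => by simp) (fun i i' k k' _ _ => by simp)
  rw [zero_mul, add_zero] at hc
  have h1 := klms_adjacent_crossed_signed_le_genTC β μ K B hR hK hAb hA hA20 hμ n ht hβ hn hβn hM Wd hWd (j := n + 2) (by omega) Qm x y hlo hhi hq8 F₁ F₁₀
    hA1 hL1 hε1 hY0B₁ hY1B₁ hY0A₁ hY1A₁ hflat₁
  have hw : ∀ k : FreqMomentum L M, 0 ≤ (fun p : FreqMomentum L M => softSymbolCompl L M β μ K (n + 1) (n + 2) p - softSymbolCompl L M β μ K (n + 1) (n + 1) p) k ∧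
      (fun p : FreqMomentum L M => softSymbolCompl L M β μ K (n + 1) (n + 2) p - softSymbolCompl L M β μ K (n + 1) (n + 1) p) k ≤
        1 - hubbardCutoffWeightCT L M β μ K (klScale klE0 (n + 1)) k :=
    fun k => softSymbolCompl_sub_compl_mem β μ K (n + 1) (show n + 1 ≤ n + 2 by omega) k
  have h2 := klms_weighted_crossed_norm_le_of_support_soft β μ K hK hβ hβL n (n + 1) ht hw Wd hWd F₂ Qm x y cen hρ hA2 hF₂ hsupp₂
  exact (norm_add_le _ _).trans (add_le_add ((norm_add_le _ _).trans (add_le_add hc h1)) h2)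

end Split3


end Summit.HubbardSuperconductivity.HubbardSuperconductivity.Theorems.KLRegimeSplit

end
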